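import Mathlib
import Literature.NumberTheory.EllipticCurves.ProfiniteGroupDistribution

/-!
# STUB-IDEAS k1 (gen 36) — «THE ATOM IS LOCAL»: the weakest sufficient global input for R197a″'s
# atom at `p = 2` is NONE, and the separation hypothesis H-FI is a theorem

Stub `stub_heegnerIndexLowerAtTwo` (LEAD skeleton `f2bd84c029a8a938`), crux
`PrintCf2.SplitBadTwoLowerHalfOfFacts` (stmt-BirchSwinnertonDyer-27851).  Technique (payload):
«weaken / strengthen (weakest sufficient form / strongest provable form)».  Node: STUB-PLAN v7.0 HARDEST (b)
= R197a″ «(KLF-COSET)₂» — after k1-g35's coset cut the open credit is (i-a) THE ATOM at `p = 2`: de Shalit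
II 4.8 (21)₀ + 4.9–4.10 (the auxiliary split prime `𝔮`) + 5.2 (3) at the exact level `n = e`, for the
finite-order characters of inertia type `θ ∈ {χ₄, χ₈, χ₈′}`; and (i-b) H-FI, the separation hypothesis
`SeparatesD 𝒰 ℂ₂ {level characters}` that k3-g29 (`CharactersSeparate`) and k1-g35 (`SeparatesD`) left as a
HYPOTHESIS.

WEAKEST SUFFICIENT FORM OF THE ATOM (Plan 1 of the card).  De Shalit's evaluation step
`δ_{0,n}(β)⁰ = log (g_β ∘ θ)(ς_n − 1) = log β_n^{σ_𝔮}` (II.5.2 (3), third line, p. 79) is the ONLY place where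
the global prime `𝔮` of Lemma 4.10 (`(𝔮, 𝔣p) = 1`, `N𝔮 ≡ 1 mod pⁿ`, `(𝔮, F_n/K) = (𝔭ⁿ, F_n/K)`, p. 63 — a
Chebotarev prime) enters the `k = 0` computation, and it enters only to UNTWIST Coleman's interpolation
`(φ^{-n} g_β)(ω_n) = β_n` (I.2.2 (13)).  The untwist is LOCAL: any `σ` in the Galois group of the local
tower `Φ·k_n / ℚ₂` (`Φ` the unramified coefficient field, `k_n = ℚ₂(E[vⁿ])`) that restricts to `φⁿ` on `Φ`
and FIXES `ω_n` gives `g_β(ω_n) = σ((φ^{-n} g_β)(ω_n)) = σ(β_n)` — §2 below is the algebra of this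
(`ringHom_eval₂_map_symm_pow`: "`σ ∘ (coefficients) = φⁿ`, `σ ω = ω` ⟹ `σ((φ⁻ⁿq)(ω)) = q(ω)`";
`exists_mem_and_map_mul_eq_one`: such a `σ = σ₀ⁿ·τ` exists as soon as the Lubin–Tate character is
surjective on the subgroup fixing `Φ` — tree ★★ `exists_absGal_fixing_ltAbsChar_eq`), and the tree already
holds the `q = 2` relative Coleman theorem (`exists_relColeman`) and the general equivariance `σ(G(y)) =
G^σ(σy)` (`algEquiv_evS`).  So at `k = 0` neither Lemma 4.10's `𝔮`, nor Prop. 4.9 (theta functions), nor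
Shimura reciprocity is needed: the (3)₂ atom on the `θ`-coset is Coleman interpolation + local untwist +
the tree's Gauss-sum engine (`BoundedDistribution.mul_sum_mulChar_mul_μ_eq_gaussSum_mul`, any `p`) +
k1-g35's primitivity kernel (`charSum_sub_pullback`).  The consumer is unaffected: the Dirac column is
`ρ_v(g)` for ANY group element `g` (k1-g35 `IsGaussDiracOnType θ C τ g` has `g` free), a unit.

STRONGEST PROVABLE FORM OF H-FI (Plan 3).  §1 proves it: on a finite level, the masses of a distribution
are determined by its character sums as soon as the value field separates the points of the level group
(`eq_zero_of_forall_charSum_eq_zero`, any finite group, Fourier inversion by the re-indexing trick); for an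
abelian level with enough roots of unity this hypothesis is Mathlib's
`CommGroup.exists_apply_ne_one_of_hasEnoughRootsOfUnity` (`eq_zero_of_forall_charSum_eq_zero_of_comm`); along
a tower of the tree's `SubgroupTower`/`GroupDistribution` currency this is exactly k1-g35's `SeparatesD` for
the family of level homomorphisms (`separatesD_levelHomFamily`) — H-FI is no longer a hypothesis in the
`𝒢′` (abelian) currency of rows 84/107.

§3 is the two-line logic of typing A′ (Plan 2): coset values filed as a SEPARATE `∃`-fact share no witness
with `DeShalit1987.thmII414_exists_lMeasure` unless uniqueness is available (`forall_of_existsUnique`).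

Everything here is abstract algebra: PROVED, no `sorry`, no `instance`, no `notation`, no `example`.  NOT
proved here (typer residue, named in the card with sizes): the tree-currency assembly `g_β^ι(ω_{m+1}) =
σ_loc(β_m)` from `exists_relColeman` + `algEquiv_evS` + `exists_absGal_fixing_ltAbsChar_eq`; the frame's
dictionary katz-masses ↔ local character sums (R216′); the value leg (5)₂.  BSD is NOT proved by any of
this; neither the crux nor the stub nor (3)₂ is.
-/

namespace Summit.BirchSwinnertonDyer.BirchSwinnertonDyer.Cruxes.SplitBadTwoLowerHalfOfFacts.LocalAtomK1G36

open Finset BigOperators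

/-! ## §1 H-FI PROVED: the character sums of a finite level determine the masses -/

section FiniteFourier

variable {Q : Type*} [Group Q]
variable {𝕜 : Type*} [Field 𝕜]

/-- **Dual orthogonality from point separation**: if the `𝕜ˣ`-valued homomorphisms of the finite group `Q`
separate `t` from `1`, then `∑_χ χ(t) = 0` (re-indexing `χ ↦ ψχ`). -/
theorem sum_hom_apply_eq_zero [Fintype (Q →* 𝕜ˣ)]
    (hsep : ∀ a : Q, a ≠ 1 → ∃ χ : Q →* 𝕜ˣ, χ a ≠ 1) {t : Q} (ht : t ≠ 1) :
    ∑ χ : Q →* 𝕜ˣ, (χ t : 𝕜) = 0 := by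
  obtain ⟨ψ, hψ⟩ := hsep t ht
  set T := ∑ χ : Q →* 𝕜ˣ, (χ t : 𝕜) with hT
  have hre : T = (ψ t : 𝕜) * T := by
    rw [hT, Finset.mul_sum]
    refine (Fintype.sum_equiv (Equiv.mulLeft ψ) _ _ fun a => ?_).symm
    simp
  have hψ' : (ψ t : 𝕜) - 1 ≠ 0 := by
    rw [sub_ne_zero]
    exact fun h1 => hψ (Units.ext h1)
  have h0 : ((ψ t : 𝕜) - 1) * T = 0 := by rw [sub_mul, one_mul, ← hre, sub_self]
  exact (mul_eq_zero.mp h0).resolve_left hψ'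

/-- **Fourier kernel**: `∑_χ χ(a⁻¹ g) = [g = a] · #Hom(Q, 𝕜ˣ)`. -/
theorem sum_hom_apply_inv_mul [DecidableEq Q] [Fintype (Q →* 𝕜ˣ)]
    (hsep : ∀ a : Q, a ≠ 1 → ∃ χ : Q →* 𝕜ˣ, χ a ≠ 1) (a g : Q) :
    ∑ χ : Q →* 𝕜ˣ, (χ (a⁻¹ * g) : 𝕜) = if g = a then (Fintype.card (Q →* 𝕜ˣ) : 𝕜) else 0 := by
  split_ifs with h
  · subst h
    simp
  · refine sum_hom_apply_eq_zero hsep ?_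
    rw [Ne, inv_mul_eq_one]
    exact fun h' => h h'.symm

/-- **H-FI on ONE finite level (any finite group)**: if every character sum `∑_g χ(g) μ(g)` of the mass
function `μ : Q → 𝕜` vanishes, `𝕜ˣ` separates the points of `Q`, and `#Hom(Q, 𝕜ˣ)` is invertible in `𝕜`,
then `μ = 0` (finite Fourier inversion: `#Hom · μ(a) = ∑_χ χ(a⁻¹) ∑_g χ(g) μ(g)`). -/
theorem eq_zero_of_forall_charSum_eq_zero [Fintype Q] [DecidableEq Q] [Fintype (Q →* 𝕜ˣ)]
    (hsep : ∀ a : Q, a ≠ 1 → ∃ χ : Q →* 𝕜ˣ, χ a ≠ 1)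
    (hN : (Fintype.card (Q →* 𝕜ˣ) : 𝕜) ≠ 0) (μ : Q → 𝕜)
    (h : ∀ χ : Q →* 𝕜ˣ, ∑ g, (χ g : 𝕜) * μ g = 0) : μ = 0 := by
  funext a
  have h1 : ∑ χ : Q →* 𝕜ˣ, (χ a⁻¹ : 𝕜) * ∑ g, (χ g : 𝕜) * μ g = 0 := by simp [h]
  have h2 : ∑ χ : Q →* 𝕜ˣ, (χ a⁻¹ : 𝕜) * ∑ g, (χ g : 𝕜) * μ g =
      ∑ g, μ g * ∑ χ : Q →* 𝕜ˣ, (χ (a⁻¹ * g) : 𝕜) := by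
    simp_rw [Finset.mul_sum, map_mul, Units.val_mul]
    rw [Finset.sum_comm]
    refine Finset.sum_congr rfl fun g _ => Finset.sum_congr rfl fun χ _ => by ring
  rw [h2] at h1
  simp_rw [sum_hom_apply_inv_mul hsep a, mul_ite, mul_zero, Finset.sum_ite_eq', Finset.mem_univ,
    if_true] at h1
  simpa [hN] using h1

/-- **H-FI on one finite ABELIAN level**: for a finite commutative group `G` and a field `𝕜` with enough
`exp(G)`-th roots of unity and `#G ≠ 0` in `𝕜`, the character sums determine the masses (point separation
= Mathlib `CommGroup.exists_apply_ne_one_of_hasEnoughRootsOfUnity`, `#Hom(G, 𝕜ˣ) = #G` = Mathlib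
`CommGroup.card_monoidHom_of_hasEnoughRootsOfUnity`). -/
theorem eq_zero_of_forall_charSum_eq_zero_of_comm {G : Type*} [CommGroup G] [Fintype G] [DecidableEq G]
    [HasEnoughRootsOfUnity 𝕜 (Monoid.exponent G)] (hG : (Fintype.card G : 𝕜) ≠ 0) (μ : G → 𝕜)
    (h : ∀ χ : G →* 𝕜ˣ, ∑ g, (χ g : 𝕜) * μ g = 0) : μ = 0 := by
  classical
  haveI : Finite (G →* 𝕜ˣ) :=
    Finite.of_equiv G (CommGroup.monoidHom_mulEquiv_of_hasEnoughRootsOfUnity G 𝕜).some.toEquiv.symm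
  letI : Fintype (G →* 𝕜ˣ) := Fintype.ofFinite _
  refine eq_zero_of_forall_charSum_eq_zero
    (fun a ha => CommGroup.exists_apply_ne_one_of_hasEnoughRootsOfUnity G 𝕜 ha) ?_ μ h
  have hc : Fintype.card (G →* 𝕜ˣ) = Fintype.card G := by
    rw [← Nat.card_eq_fintype_card, CommGroup.card_monoidHom_of_hasEnoughRootsOfUnity G 𝕜,
      Nat.card_eq_fintype_card]
  rwa [hc]

/-- Equality form: two mass functions with the same character sums coincide. -/
theorem eq_of_forall_charSum_eq_of_comm {G : Type*} [CommGroup G] [Fintype G] [DecidableEq G]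
    [HasEnoughRootsOfUnity 𝕜 (Monoid.exponent G)] (hG : (Fintype.card G : 𝕜) ≠ 0) (μ₁ μ₂ : G → 𝕜)
    (h : ∀ χ : G →* 𝕜ˣ, ∑ g, (χ g : 𝕜) * μ₁ g = ∑ g, (χ g : 𝕜) * μ₂ g) : μ₁ = μ₂ := by
  have h0 := eq_zero_of_forall_charSum_eq_zero_of_comm hG (fun g => μ₁ g - μ₂ g) fun χ => by
    simp only [mul_sub, Finset.sum_sub_distrib, h χ, sub_self]
  funext g
  exact sub_eq_zero.mp (congr_fun h0 g)

end FiniteFourier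

/-! ### H-FI in rows 84/107's currency (tree `SubgroupTower` / `GroupDistribution`, k1-g35 `SeparatesD`) -/

section TowerCurrency

open Literature.NumberTheory.EllipticCurves Literature.NumberTheory.EllipticCurves.GroupDistribution

variable {G : Type*} [CommGroup G]

/-- k1-g35's `CosetCutK1G35.SeparatesD`, verbatim (k3-g29's `CharactersSeparate` is the case of the level
characters): a family of test functions SEPARATES if equal integrals force equal masses. -/
def SeparatesD (𝒰 : SubgroupTower G) (𝕜 : Type*) [NormedField 𝕜] (𝔛 : Set (G → 𝕜)) : Prop :=
  ∀ D₁ D₂ : GroupDistribution 𝒰 𝕜,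
    (∀ χ ∈ 𝔛, D₁.integral χ = D₂.integral χ) → ∀ n a, D₁.μ n a = D₂.μ n a

/-- The family of LEVEL HOMOMORPHISMS: `σ ↦ χ(σ U_n)` for `χ : G ⧸ U_n →* 𝕜ˣ` (the finite-order characters of
`𝒢′` factoring through a level of the ray-class tower). -/
def levelHomFamily (𝒰 : SubgroupTower G) (𝕜 : Type*) [NormedField 𝕜] : Set (G → 𝕜) :=
  {f | ∃ (n : ℕ) (χ : G ⧸ 𝒰.U n →* 𝕜ˣ), f = fun σ => (χ (𝒰.proj n σ) : 𝕜)}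

/-- **H-FI PROVED (tower form)**: along any tower of finite-index subgroups of a commutative group, over a
normed field containing the `exp(G ⧸ U_n)`-th roots of unity and in which the level cardinalities are
non-zero (e.g. `ℂ₂`, or any field of characteristic `0` containing `μ_{2^∞}`-enough), the level homomorphisms
SEPARATE bounded distributions: equal integrals against every `χ ∘ proj_n` force equal masses.  This
discharges hypothesis `CharactersSeparate` (k3-g29) = `SeparatesD … {level characters}` (k1-g35) = H-FI of
STUB-PLAN v7.0 in the abelian (`𝒢′`) currency. -/
theorem separatesD_levelHomFamily (𝒰 : SubgroupTower G) (𝕜 : Type*) [NormedField 𝕜]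
    (hroots : ∀ n, HasEnoughRootsOfUnity 𝕜 (Monoid.exponent (G ⧸ 𝒰.U n)))
    (hcard : ∀ n, ((𝒰.cells n).card : 𝕜) ≠ 0) :
    SeparatesD 𝒰 𝕜 (levelHomFamily 𝒰 𝕜) := by
  intro D₁ D₂ hint n a
  classical
  letI : Fintype (G ⧸ 𝒰.U n) := 𝒰.cellFintype n
  haveI := hroots n
  have huniv : (Finset.univ : Finset (G ⧸ 𝒰.U n)) = 𝒰.cells n := rfl
  have hG : (Fintype.card (G ⧸ 𝒰.U n) : 𝕜) ≠ 0 := by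
    rw [← Finset.card_univ, huniv]
    exact hcard n
  have key : (fun b => D₁.μ n b) = fun b => D₂.μ n b := by
    refine eq_of_forall_charSum_eq_of_comm hG _ _ fun χ => ?_
    have hmem : (fun σ => (χ (𝒰.proj n σ) : 𝕜)) ∈ levelHomFamily 𝒰 𝕜 := ⟨n, χ, rfl⟩
    have h12 := hint _ hmem
    rw [D₁.integral_eq_sum_of_factorsThrough (fun b => (χ b : 𝕜)) fun _ => rfl,
      D₂.integral_eq_sum_of_factorsThrough (fun b => (χ b : 𝕜)) fun _ => rfl, ← huniv] at h12
    simpa only [mul_comm (D₁.μ n _), mul_comm (D₂.μ n _)] using h12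
  exact congr_fun key a

end TowerCurrency

/-! ## §2 THE ATOM IS LOCAL: the untwist of Coleman's interpolation needs no auxiliary prime

De Shalit I.2.2 (13): `(φ^{-n} g_β)(ω_n) = β_n`; II.4.10: a global prime `𝔮` with `(𝔮, F_n/K) = (𝔭ⁿ, F_n/K)`,
`N𝔮 ≡ 1 mod pⁿ` turns this into `g_β(θ(ς_n − 1)) = σ_𝔮(β_n)` (Step 1, p. 64).  The algebra of the untwist:
for ANY ring endomorphism `σ` of the value ring that induces `φⁿ` on the coefficient ring and fixes the
evaluation point, `σ((φ^{-n} q)(ω)) = q(ω)`.  Locally such a `σ` is `σ₀ⁿ·τ` with `σ₀` an arithmetic Frobenius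
and `τ` in the subgroup fixing the coefficient field, chosen through the surjectivity of the Lubin–Tate
character on that subgroup (tree ★★ `exists_absGal_fixing_ltAbsChar_eq`) — `exists_mem_and_map_mul_eq_one`. -/

section Untwist

/-- **The local untwist element exists, (α) coefficient side** (group theory of
`Gal(Φ·k_n/ℚ₂) ⊇ Gal(Φ·k_n/Φ) ↠ (𝒪/πⁿ⁺¹)ˣ`): if a character `χ` of `Γ` is surjective on a subgroup `H`, every
`γ ∈ Γ` can be corrected by some `τ ∈ H` to any prescribed value `χ(γτ) = u₀` — in particular `u₀ = 1`
(`σ_loc = σ₀ⁿ·τ` fixes the coherent point) or `u₀ =` the unit carrying `ω_n` to `θ(ς_n − 1)`.  (Use: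
`Γ = Γ_{ℚ₂}`, `H = Γ_Φ`, `χ` = the Lubin–Tate character mod `πⁿ⁺¹` — surjective on `Γ_Φ` by the tree's ★★
`exists_absGal_fixing_ltAbsChar_eq` — and `γ = σ₀ⁿ⁺¹`, `σ₀` an arithmetic Frobenius.) -/
theorem exists_mem_and_map_mul_eq {Γ U : Type*} [Group Γ] [Group U] (χ : Γ →* U) (H : Subgroup Γ)
    (hsurj : ∀ u : U, ∃ τ ∈ H, χ τ = u) (γ : Γ) (u₀ : U) : ∃ τ ∈ H, χ (γ * τ) = u₀ := by
  obtain ⟨τ, hτ, h⟩ := hsurj ((χ γ)⁻¹ * u₀)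
  exact ⟨τ, hτ, by rw [map_mul, h, mul_inv_cancel_left]⟩

/-- The case `u₀ = 1`: `σ_loc = γ·τ` lies in the kernel of `χ` (fixes the level-`n` torsion). -/
theorem exists_mem_and_map_mul_eq_one {Γ U : Type*} [Group Γ] [Group U] (χ : Γ →* U) (H : Subgroup Γ)
    (hsurj : ∀ u : U, ∃ τ ∈ H, χ τ = u) (γ : Γ) : ∃ τ ∈ H, χ (γ * τ) = 1 :=
  exists_mem_and_map_mul_eq χ H hsurj γ 1

/-- **The local untwist element exists, (β) point side**: if `H` acts on the torsion through scalars
commuting with the `R`-module structure (`τ(c·x) = c·τ(x)`: the formal-module endomorphisms have coefficients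
fixed by `H`) and moves the root `λ` to every `u·λ`, then it moves `c·λ` to `(u c)·λ` — every primitive point
to every other (the target `θ(ς_n − 1)` of II.4.8 (20) included): transitivity, no `N𝔮 ≡ 1 mod pⁿ`. -/
theorem exists_mem_smul_smul_eq {Γ R X : Type*} [Group Γ] [CommMonoid R] [MulAction Γ X] [MulAction R X]
    (H : Subgroup Γ) (l : X) (hcomm : ∀ τ ∈ H, ∀ (c : R) (x : X), τ • (c • x) = c • (τ • x))
    (hsurj : ∀ u : R, ∃ τ ∈ H, τ • l = u • l) (c u : R) : ∃ τ ∈ H, τ • (c • l) = (u * c) • l := by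
  obtain ⟨τ, hτ, h⟩ := hsurj u
  exact ⟨τ, hτ, by rw [hcomm τ hτ, h, ← mul_smul, mul_comm]⟩

/-- Coefficients of an iterated coefficient map. -/
theorem coeff_map_iterate {A : Type*} [CommSemiring A] (f : A →+* A) (n k : ℕ) (g : PowerSeries A) :
    PowerSeries.coeff k ((PowerSeries.map f)^[n] g) = f^[n] (PowerSeries.coeff k g) := by
  induction n generalizing g with
  | zero => rfl
  | succ n ih =>
    rw [Function.iterate_succ_apply', Function.iterate_succ_apply', PowerSeries.coeff_map, ih]

/-- **`(φ)ⁿ ∘ (φ⁻¹)ⁿ = id` on power series** (the shape `(PowerSeries.map φ.symm)^[m+1] g` of the tree's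
`exists_relColeman`). -/
theorem map_iterate_map_symm_iterate {A : Type*} [CommSemiring A] (φ : A ≃+* A) (n : ℕ)
    (g : PowerSeries A) :
    (PowerSeries.map (φ : A →+* A))^[n] ((PowerSeries.map (φ.symm : A →+* A))^[n] g) = g := by
  have hli : Function.LeftInverse (PowerSeries.map (φ : A →+* A))
      (PowerSeries.map (φ.symm : A →+* A)) := by
    intro x
    ext k
    simp [PowerSeries.coeff_map]
  exact hli.iterate n g

/-- **Coefficient form of the untwist**: a coefficient map `j` that factors as `i ∘ φⁿ` sends `(φ⁻¹)ⁿ g` to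
`i g` — "`σ` restricted to `𝒪_Φ` is `φⁿ`" read on power series. -/
theorem map_comp_pow_map_symm_iterate {A B : Type*} [CommSemiring A] [CommSemiring B] (i : A →+* B)
    (φ : A ≃+* A) (n : ℕ) (g : PowerSeries A) :
    PowerSeries.map (i.comp ((φ : A →+* A) ^ n)) ((PowerSeries.map (φ.symm : A →+* A))^[n] g) =
      PowerSeries.map i g := by
  ext k
  rw [PowerSeries.coeff_map, PowerSeries.coeff_map, coeff_map_iterate, RingHom.comp_apply,
    RingHom.coe_pow]
  congr 1
  exact (Function.LeftInverse.iterate (fun x => φ.apply_symm_apply x) n) (PowerSeries.coeff k g)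

/-- **THE UNTWIST (polynomial avatar of I.2.2 (13) ↦ II.5.2 (3))**: if `σ` induces `φⁿ` on coefficients
(`σ ∘ i = i ∘ φⁿ`) and fixes the evaluation point `ω`, then `σ((φ^{-n} q)(ω)) = q(ω)`.  Read backwards with
`(φ^{-n} g_β)(ω_n) = β_n`: **`g_β(ω_n) = σ(β_n)`** for a LOCAL `σ` — no auxiliary prime `𝔮`, no `N𝔮 ≡ 1`,
no reciprocity law.  (Power series: the tree's `algEquiv_evS` `σ(G(y)) = G^σ(σ y)` replaces
`Polynomial.hom_eval₂`.) -/
theorem ringHom_eval₂_map_symm_pow {A B : Type*} [CommSemiring A] [CommSemiring B] (i : A →+* B)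
    (φ : A ≃+* A) (σ : B →+* B) (n : ℕ) (hσ : ∀ a, σ (i a) = i (((φ : A →+* A) ^ n) a)) {ω : B}
    (hω : σ ω = ω) (q : Polynomial A) :
    σ ((q.map ((φ.symm : A →+* A) ^ n)).eval₂ i ω) = q.eval₂ i ω := by
  rw [Polynomial.hom_eval₂, Polynomial.eval₂_map, hω]
  congr 1
  ext a
  rw [RingHom.comp_apply, RingHom.comp_apply, hσ, RingHom.coe_pow, RingHom.coe_pow]
  congr 1
  exact (Function.LeftInverse.iterate (fun x => φ.apply_symm_apply x) n) a

/-- **Equivariant form** (the shape actually met: `σ` moves the point, `σ ω = ω'`): `σ((φ^{-n}q)(ω)) = q(ω')`.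
With `ω' = ω` this is the untwist; with `σ ∈` inertia (`φⁿ` replaced by `id`, `n = 0`) it is the Galois
equivariance `σ(q(ω)) = q(σω)` that produces the character sums of (21). -/
theorem ringHom_eval₂_map_symm_pow_of_apply_eq {A B : Type*} [CommSemiring A] [CommSemiring B]
    (i : A →+* B) (φ : A ≃+* A) (σ : B →+* B) (n : ℕ)
    (hσ : ∀ a, σ (i a) = i (((φ : A →+* A) ^ n) a)) {ω ω' : B} (hω : σ ω = ω') (q : Polynomial A) :
    σ ((q.map ((φ.symm : A →+* A) ^ n)).eval₂ i ω) = q.eval₂ i ω' := by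
  rw [Polynomial.hom_eval₂, Polynomial.eval₂_map, hω]
  congr 1
  ext a
  rw [RingHom.comp_apply, RingHom.comp_apply, hσ, RingHom.coe_pow, RingHom.coe_pow]
  congr 1
  exact (Function.LeftInverse.iterate (fun x => φ.apply_symm_apply x) n) a

/-- **Reading the local element in the global group costs nothing**: an automorphism of the big field
restricts to the normal subextension (Mathlib `AlgEquiv.restrictNormal`, `AlgEquiv.restrictNormal_commutes`);
recorded here in the form the frame uses — the restriction is compatible with the embedding. -/
theorem restrictNormal_compatible {K L Ω : Type*} [Field K] [Field L] [Field Ω] [Algebra K L] [Algebra K Ω]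
    [Algebra L Ω] [IsScalarTower K L Ω] [Normal K L] (σ : Ω ≃ₐ[K] Ω) (x : L) :
    algebraMap L Ω (σ.restrictNormal L x) = σ (algebraMap L Ω x) :=
  AlgEquiv.restrictNormal_commutes σ L x

end Untwist

/-! ## §3 Typing A′: coset values must ride on the SAME `∃μ` -/

section OneFact

/-- **The two-`∃` trap and its only escape.**  If the measure fact is `∃ μ, P μ` (tree
`DeShalit1987.thmII414_exists_lMeasure`: "Uniqueness of `μ` […] NOT typed") and the coset values are filed
as a second fact `∃ μ, P μ ∧ C μ`, the frame's witness of the first satisfies `C` only through UNIQUENESS of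
the `P`-witness.  Hence typing A′ = ONE strengthened fact `∃ μ, P μ ∧ C μ` (with the projection to the old
fact), or uniqueness proved first. -/
theorem forall_of_existsUnique {α : Sort*} {P C : α → Prop} (hu : ∃! x, P x) (h : ∃ x, P x ∧ C x) :
    ∀ x, P x → C x := by
  obtain ⟨x₀, hx₀, hC⟩ := h
  intro x hx
  rwa [hu.unique hx hx₀]

/-- The projection `A′ → A` (the strengthened fact still delivers the frame's measure fact). -/
theorem exists_of_exists_and {α : Sort*} {P C : α → Prop} (h : ∃ x, P x ∧ C x) : ∃ x, P x :=
  h.imp fun _ hx => hx.1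

end OneFact

end Summit.BirchSwinnertonDyer.BirchSwinnertonDyer.Cruxes.SplitBadTwoLowerHalfOfFacts.LocalAtomK1G36
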